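import Summits.KontsevichZagierPeriods.KontsevichZagierPeriods.Theorems.ReductionTwoSix.Negative.Bookkeeping

/-!
# `ReductionTwoSix` (stmt-KontsevichZagierPeriods-3871) — negative side VI: which dilation ENGINES can work

Refuter (`cdisprove`, cycle 2) by-product, kernel-checked; the negative counterpart of `Negative/Bookkeeping`
and `Negative/Relative`. The idea cards for this crux agree on the mechanism (Kubert distribution relations =
the dilations `x ↦ x^m` on the open box) and differ only in the ENGINE: which exponents `m`, and whether the
polynomial part goes by one dilation `m = k+1` per monomial (line jacobian-monomials, picked) or by rule 3
with a finite engine `{Φ₂, Φ₃}` (card euler-stokes-polynomial-descent). In the abstract in-sector model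
(rule 1b + the named dilations read on the level-6 box sector, exactly as in `bookkeeping`):

* POLYNOMIAL PART (`section NoFiniteEngine`). `U_m F = m²·X^(m-1)·F(X^m)` is the integrand action of the
  dilation (`aeval_dilOp`). For a prime `p` the fake period `Λ_p (Σ a_k X^k) = Σ a_k [p ∣ k+1]/(k+1)²` is
  invariant under every `U_m` with `p ∤ m` and kills constants, but `Λ_p (X^(p-1)) = 1/p²`:
  `monomial_not_normalisable` (modulo additivity and all dilations with exponent coprime to `p`, `X^(p-1)`
  is equivalent to NO constant), `monomial_normalisable_by_p` (one move `m = p` suffices — tight),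
  `no_finite_dilation_engine` (NO FINITE set of exponents normalises every polynomial part).
* RESIDUE PART (`section KubertEngine`, notation of `bookkeeping`: `φ r q` = class of `[q·t^r/(1−t⁶)]`).
  `dil3_1_of_u6` / `bookkeeping_via_u6`: the level-1 lift `U₆` (`φ 5 (36q) = Σ_r φ r q`) replaces
  `Dil₃ (r = 1)` — the level-2 lift `m = 3` is dispensable; `kubert_false_without_dil2`: the level-3 lift
  `m = 2` is LOAD-BEARING (rational model `ψ = (1,1,0,−1,−1,0)` of `Dil₃(0), Dil₃(1), U₆` in which `P = 1`
  has no normal form); `kubert_false_with_dil2_only`: the three `Dil₂` alone are insufficient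
  (`ψ = (3,1,−6,1,3,−2)`). Minimal residue engines: `{Dil₂(0),Dil₂(1),Dil₂(2)} + {Dil₃(1) or U₆}`.
* WHOLE SECTOR: see the companion `Negative/InSector` (`inSector_finite_engine_fails`: the full in-sector
  numerator model with all three Kubert lifts and any finite polynomial engine still fails the crux).
UPSHOT: rules 1b + 2 restricted to the sector with finitely many dilation maps cannot prove the crux; the
proof in `Negative/Relative` + the closing file escapes exactly through the unbounded family `m = k+1`
(forced among dilation-only proofs), and a finite engine must use rule 3 for the polynomial part.
Scope: statements about abstract move sets (like `bookkeeping`); they do not constrain rule 3 or changes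
of variables other than `x ↦ x^m`. [Milnor 1983 (Kubert identities); Kontsevich–Zagier 2001 §1.2]
-/

namespace Summit.KontsevichZagierPeriods.HurwitzMicroSectors.ReductionTwoSixNegative

section NoFiniteEngine

open Polynomial

/-- The dilation `t ↦ t^m` read on a polynomial integrand `F(xy)` on the box `(0,1)²`:
`U_m F = m² · X^(m-1) · F(X^m)` (Jacobian factor `m²(xy)^(m-1)`), as an additive endomorphism. -/
noncomputable def dilOp (m : ℕ) : ℚ[X] →+ ℚ[X] :=
  AddMonoidHom.mk' (fun F => C ((m : ℚ) ^ 2) * X ^ (m - 1) * expand ℚ m F) fun F G => by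
    simp only [map_add, mul_add]

/-- Auxiliary: `dilOp_apply`. -/
theorem dilOp_apply (m : ℕ) (F : ℚ[X]) :
    dilOp m F = C ((m : ℚ) ^ 2) * X ^ (m - 1) * expand ℚ m F := rfl

/-- DICTIONARY: `(U_m F)(t) = m² t^(m-1) F(t^m)` — the integrand relation of the dilation move
`x ↦ (x₀^m, x₁^m)` between the box representations of `U_m F (xy)` and `F(xy)` (`t = xy`,
`|det| = m² (x₀x₁)^(m-1)`), i.e. the hypothesis of `S_dil` / `DilationMoveDim 2`. -/
theorem aeval_dilOp (m : ℕ) (F : ℚ[X]) (t : ℝ) :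
    aeval t (dilOp m F) = (m : ℝ) ^ 2 * t ^ (m - 1) * aeval (t ^ m) F := by
  simp only [dilOp_apply, map_mul, map_pow, aeval_C, aeval_X, expand_aeval, eq_ratCast]
  push_cast; ring

/-- `U_m` on monomials: `U_m (a X^k) = m² a · X^(m(k+1)−1)`. -/
theorem dilOp_monomial {m : ℕ} (hm : 1 ≤ m) (k : ℕ) (a : ℚ) :
    dilOp m (monomial k a) = monomial (m * (k + 1) - 1) ((m : ℚ) ^ 2 * a) := by
  rw [dilOp_apply, expand_monomial, C_mul_X_pow_eq_monomial, monomial_mul_monomial]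
  have hmk : 1 ≤ m * (k + 1) := Nat.one_le_iff_ne_zero.mpr (Nat.mul_ne_zero (by omega) (by omega))
  have e : m - 1 + k * m = m * (k + 1) - 1 := by zify [hm, hmk]; ring
  rw [e]

/-- The fake weight `wt p k = [p ∣ k+1] / (k+1)²` (the true weight is `1/(k+1)² = ∬ (xy)^k`). -/
def wt (p k : ℕ) : ℚ := if p ∣ k + 1 then 1 / ((k : ℚ) + 1) ^ 2 else 0

/-- The fake period functional `Λ_p (Σ a_k X^k) = Σ_k a_k · wt p k`. -/
noncomputable def Lam (p : ℕ) : ℚ[X] →+ ℚ :=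
  (lsum (fun k => wt p k • (LinearMap.id : ℚ →ₗ[ℚ] ℚ)) : ℚ[X] →ₗ[ℚ] ℚ).toAddMonoidHom

/-- Auxiliary: `Lam_monomial`. -/
theorem Lam_monomial (p k : ℕ) (a : ℚ) : Lam p (monomial k a) = wt p k * a := by
  simp [Lam, lsum_apply, sum_monomial_index]

/-- Auxiliary: `Lam_C`. -/
theorem Lam_C (p : ℕ) (a : ℚ) : Lam p (C a) = wt p 0 * a := by
  rw [← monomial_zero_left, Lam_monomial]

/-- Auxiliary: `Lam_X_pow`. -/
theorem Lam_X_pow (p k : ℕ) : Lam p (X ^ k) = wt p k := by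
  rw [X_pow_eq_monomial, Lam_monomial, mul_one]

/-- INVARIANCE: `Λ_p ∘ U_m = Λ_p` whenever `p` is prime and `p ∤ m` (`Λ_p` is a model of rule 1b +
all dilations with exponent coprime to `p`). -/
theorem Lam_dilOp {p m : ℕ} (hp : p.Prime) (hm : 1 ≤ m) (hpm : ¬ p ∣ m) (F : ℚ[X]) :
    Lam p (dilOp m F) = Lam p F := by
  suffices h : (Lam p).comp (dilOp m) = Lam p from DFunLike.congr_fun h F
  refine Polynomial.addHom_ext fun k a => ?_
  rw [AddMonoidHom.comp_apply, dilOp_monomial hm, Lam_monomial, Lam_monomial]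
  have hmk : 1 ≤ m * (k + 1) := Nat.one_le_iff_ne_zero.mpr (Nat.mul_ne_zero (by omega) (by omega))
  have hcast : ((m * (k + 1) - 1 : ℕ) : ℚ) + 1 = (m : ℚ) * ((k : ℚ) + 1) := by
    rw [Nat.cast_sub hmk]; push_cast; ring
  have hdvd : (p ∣ m * (k + 1) - 1 + 1) ↔ (p ∣ k + 1) := by
    rw [Nat.sub_add_cancel hmk, hp.dvd_mul]
    exact ⟨fun h => h.resolve_left hpm, Or.inr⟩
  unfold wt
  rw [hcast]
  by_cases hk : p ∣ k + 1
  · rw [if_pos (hdvd.mpr hk), if_pos hk]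
    have : (m : ℚ) ≠ 0 := by exact_mod_cast (show m ≠ 0 by omega)
    field_simp
  · rw [if_neg (fun h => hk (hdvd.mp h)), if_neg hk, zero_mul, zero_mul]

/-- `Λ_p` kills every constant (`p` prime, so `p ∤ 1`). -/
theorem Lam_C_eq_zero {p : ℕ} (hp : p.Prime) (a : ℚ) : Lam p (C a) = 0 := by
  rw [Lam_C, wt, if_neg (by simpa using hp.ne_one), zero_mul]

/-- `Λ_p (X^(p-1)) = 1/p²` (the TRUE value — but `Λ_p` of the matching constant is `0`). -/
theorem Lam_X_pow_pred {p : ℕ} (hp : p.Prime) : Lam p (X ^ (p - 1)) = 1 / (p : ℚ) ^ 2 := by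
  rw [Lam_X_pow, wt, Nat.sub_add_cancel hp.one_lt.le, if_pos dvd_rfl, Nat.cast_sub hp.one_lt.le]
  push_cast; ring

/-- The span of the dilation relations `U_m F − F`, `m ∈ M`, inside the additive group `ℚ[X]` of
polynomial integrands on the box (integrand additivity is built into the ambient group). -/
noncomputable def dilSpan (M : Set ℕ) : AddSubgroup ℚ[X] :=
  AddSubgroup.closure {G | ∃ m ∈ M, ∃ F : ℚ[X], G = dilOp m F - F}

/-- `Λ_p` vanishes on the span of the dilations with exponents coprime to `p`. -/
theorem Lam_eq_zero_of_mem_dilSpan {p : ℕ} (hp : p.Prime) {M : Set ℕ}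
    (hM : ∀ m ∈ M, 1 ≤ m ∧ ¬ p ∣ m) {G : ℚ[X]} (hG : G ∈ dilSpan M) : Lam p G = 0 := by
  refine (AddSubgroup.closure_le (K := (Lam p).ker)).mpr ?_ hG
  rintro _ ⟨m, hm, F, rfl⟩
  rw [SetLike.mem_coe, AddMonoidHom.mem_ker, map_sub, Lam_dilOp hp (hM m hm).1 (hM m hm).2, sub_self]

/-- PRIME NO-GO (refuted strengthening "dilations with exponents coprime to `p` suffice"): modulo
additivity and all `U_m` with `p ∤ m`, the monomial `X^(p-1)` is equivalent to NO constant. For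
`p = 5` this is the in-sector statement: the Kubert engine `{2, 3, 6}` never reaches `X⁴ ↔ 1/25`. -/
theorem monomial_not_normalisable {p : ℕ} (hp : p.Prime) {M : Set ℕ}
    (hM : ∀ m ∈ M, 1 ≤ m ∧ ¬ p ∣ m) (a : ℚ) : X ^ (p - 1) - C a ∉ dilSpan M := fun h => by
  have := Lam_eq_zero_of_mem_dilSpan hp hM h
  rw [map_sub, Lam_X_pow_pred hp, Lam_C_eq_zero hp, sub_zero] at this
  exact absurd this (by have := hp.pos; positivity)

/-- TIGHT: one dilation with exponent `m = p` normalises `X^(p-1)` (`U_p (1/p²) = X^(p-1)`; this is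
`S_dil_monomial` with `k + 1 = p`). -/
theorem monomial_normalisable_by_p {p : ℕ} (hp : 1 ≤ p) :
    X ^ (p - 1) - C (1 / (p : ℚ) ^ 2) ∈ dilSpan {p} := by
  have h : dilOp p (C (1 / (p : ℚ) ^ 2)) - C (1 / (p : ℚ) ^ 2) =
      X ^ (p - 1) - C (1 / (p : ℚ) ^ 2) := by
    rw [← monomial_zero_left, dilOp_monomial hp, monomial_zero_left]
    have : (p : ℚ) ≠ 0 := by exact_mod_cast (show p ≠ 0 by omega)
    rw [show (p : ℚ) ^ 2 * (1 / (p : ℚ) ^ 2) = 1 by field_simp, Nat.zero_add, Nat.mul_one,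
      ← X_pow_eq_monomial]
  rw [← h]
  exact AddSubgroup.subset_closure ⟨p, rfl, _, rfl⟩

/-- NO FINITE DILATION ENGINE: for every finite set `M` of exponents there is a monomial `X^k`
(`k = p − 1`, `p` a prime exceeding `max M`) equivalent to NO constant modulo additivity + the
`M`-dilations. Any dilation-only normalisation of ALL polynomial parts uses infinitely many exponents. -/
theorem no_finite_dilation_engine (M : Finset ℕ) (hM : ∀ m ∈ M, 1 ≤ m) :
    ∃ k : ℕ, ∀ a : ℚ, X ^ k - C a ∉ dilSpan (M : Set ℕ) := by
  obtain ⟨p, hpgt, hp⟩ := Nat.exists_infinite_primes (M.sup id + 1)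
  refine ⟨p - 1, fun a => monomial_not_normalisable hp (fun m hm => ⟨hM m hm, fun hdvd => ?_⟩) a⟩
  have h1 : m ≤ M.sup id := Finset.le_sup (f := id) hm
  have h2 : p ≤ m := Nat.le_of_dvd (hM m hm) hdvd
  omega

end NoFiniteEngine

section KubertEngine

variable {V : Type*} [AddCommGroup V]

/-- `U₆` on level 1 (`φ 5 (36q) = Σ_r φ r q`) implies `Dil₃ (r = 1)` given the three `Dil₂`. -/
theorem dil3_1_of_u6 (φ : Fin 6 → ℚ →+ V)
    (dil2_0 : ∀ q : ℚ, φ 1 (4 * q) = φ 0 q + φ 3 q)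
    (dil2_1 : ∀ q : ℚ, φ 3 (4 * q) = φ 1 q + φ 4 q)
    (dil2_2 : ∀ q : ℚ, φ 5 (4 * q) = φ 2 q + φ 5 q)
    (u6 : ∀ q : ℚ, φ 5 (36 * q) = ∑ r, φ r q) (q : ℚ) :
    φ 5 (9 * q) = φ 1 q + φ 3 q + φ 5 q := by
  have hsum : ∀ μ : ℚ, ∑ r, φ r μ = φ 1 (4 * μ) + φ 3 (4 * μ) + φ 5 (4 * μ) := fun μ => by
    simp only [Fin.sum_univ_six]
    rw [dil2_0, dil2_1, dil2_2]
    abel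
  have key : ∀ μ : ℚ, φ 1 (4 * μ) + φ 3 (4 * μ) = φ 5 (32 * μ) := fun μ => by
    have h := u6 μ
    rw [hsum] at h
    have e : φ 5 (32 * μ) = φ 5 (36 * μ) - φ 5 (4 * μ) := by rw [← map_sub]; congr 1; ring
    rw [e, h]; abel
  have k := key (q / 4)
  rw [show 4 * (q / 4) = q by ring, show 32 * (q / 4) = 8 * q by ring] at k
  have e : φ 5 (9 * q) = φ 5 (8 * q) + φ 5 q := by rw [← map_add]; congr 1; ring
  rw [e, ← k]

/-- BOOKKEEPING WITHOUT THE LEVEL-2 LIFT: the three `Dil₂` and `U₆` already give the normal form of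
§1 (same coefficients `bCoeff`, `cCoeff`). -/
theorem bookkeeping_via_u6 (φ : Fin 6 → ℚ →+ V)
    (dil2_0 : ∀ q : ℚ, φ 1 (4 * q) = φ 0 q + φ 3 q)
    (dil2_1 : ∀ q : ℚ, φ 3 (4 * q) = φ 1 q + φ 4 q)
    (dil2_2 : ∀ q : ℚ, φ 5 (4 * q) = φ 2 q + φ 5 q)
    (u6 : ∀ q : ℚ, φ 5 (36 * q) = ∑ r, φ r q) (p : Fin 6 → ℚ) :
    ∑ r, φ r (p r) =
      ∑ r, φ r (bCoeff p) +
        (φ 0 (cCoeff p) - φ 1 (cCoeff p) + φ 3 (cCoeff p) - φ 4 (cCoeff p)) :=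
  bookkeeping φ dil2_0 dil2_1 dil2_2 (dil3_1_of_u6 φ dil2_0 dil2_1 dil2_2 u6) p

/-- The rational model killing `Dil₃ (0)`, `Dil₃ (1)`, `U₆` and every normal form, but not `[1/(1−t⁶)]`. -/
def psiNoDil2 : Fin 6 → ℚ := ![1, 1, 0, -1, -1, 0]

/-- THE LEVEL-3 LIFT (`m = 2`) IS LOAD-BEARING: a model of `Dil₃ (r = 0)`, `Dil₃ (r = 1)` and `U₆` in
which `P = 1` has no normal form. -/
theorem kubert_false_without_dil2 : ∃ φ : Fin 6 → ℚ →+ ℚ,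
    (∀ q : ℚ, φ 2 (9 * q) = φ 0 q + φ 2 q + φ 4 q) ∧
    (∀ q : ℚ, φ 5 (9 * q) = φ 1 q + φ 3 q + φ 5 q) ∧
    (∀ q : ℚ, φ 5 (36 * q) = ∑ r, φ r q) ∧
    ¬ ∃ b c : ℚ, φ 0 1 = ∑ r, φ r b + (φ 0 c - φ 1 c + φ 3 c - φ 4 c) := by
  refine ⟨fun r => AddMonoidHom.mulLeft (psiNoDil2 r), fun q => ?_, fun q => ?_, fun q => ?_, ?_⟩
  · simp [psiNoDil2]
  · simp [psiNoDil2]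
  · simp [psiNoDil2, Fin.sum_univ_six]
  · rintro ⟨b, c, h⟩
    simp [psiNoDil2, Fin.sum_univ_six] at h

/-- The rational model killing the three `Dil₂` and every normal form, but not `[1/(1−t⁶)]`. -/
def psiDil2Only : Fin 6 → ℚ := ![3, 1, -6, 1, 3, -2]

/-- `Dil₂ (0,1,2)` ALONE DO NOT SUFFICE: a model of the three `Dil₂` in which `P = 1` has no normal
form (so `Dil₃ (1)` or `U₆` is needed on top). -/
theorem kubert_false_with_dil2_only : ∃ φ : Fin 6 → ℚ →+ ℚ,
    (∀ q : ℚ, φ 1 (4 * q) = φ 0 q + φ 3 q) ∧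
    (∀ q : ℚ, φ 3 (4 * q) = φ 1 q + φ 4 q) ∧
    (∀ q : ℚ, φ 5 (4 * q) = φ 2 q + φ 5 q) ∧
    ¬ ∃ b c : ℚ, φ 0 1 = ∑ r, φ r b + (φ 0 c - φ 1 c + φ 3 c - φ 4 c) := by
  refine ⟨fun r => AddMonoidHom.mulLeft (psiDil2Only r), fun q => ?_, fun q => ?_, fun q => ?_, ?_⟩
  · simp [psiDil2Only]; ring
  · simp [psiDil2Only]; ring
  · simp [psiDil2Only]; ring
  · rintro ⟨b, c, h⟩
    simp [psiDil2Only, Fin.sum_univ_six] at h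
    linarith

end KubertEngine

end Summit.KontsevichZagierPeriods.HurwitzMicroSectors.ReductionTwoSixNegative
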